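import Summits.Langlands.Langlands.Theorems.IrreducibilityBySelfDualityIrreducibleOffSectorNonAutomorphicConstituent
import Summits.Langlands.Langlands.Theorems.IrreducibilityBySelfDualityIrreducibleOffSectorTriangularFactors
import Summits.Langlands.Langlands.Theorems.IrreducibilityBySelfDualityIrreducibleOffSectorRegularArithmetic
import Summits.Langlands.Langlands.Theorems.IrreducibilityBySelfDualityIrreducibleOffSectorOfArithmetic
import HarnessLib

/-!
# No abelian and no triangularisable avatars of cuspidal `π` — L-arithmetic and regular cases
(crux stmt-Langlands-14329 `IrreducibilityBySelfDuality.IrreducibleOffSector`, line `Sketch`;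
`--supports` file, STRUCTURAL: no import of the route module; continuation lead c8, CONSTITUENT package)

`not_charpoly_eq_prod_rank_one_of_rational` (p130708) forbids, for EVERY cuspidal `π` on `GL_n(𝔸_K)`
(`n ≥ 2`, every number field `K`) and every a.e.-compatible `ρ : Γ_K → GL_n(ℚ̄_ℓ)` that is `E`-rational
almost everywhere, a factorisation `det(X - ρ σ) = ∏ᵢ det(X - χ_i σ)` into `n` continuous characters,
modulo Böckle–Hui 2025 Thm. 1.1 (text of the tree theorem `WeakAbelianSummandHecke`) and Arthur–Clozel
(2.2).  This file removes the `E`-rationality hypothesis in the two regimes where it is known and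
records the frame-theoretic form:

* `not_charpoly_eq_prod_rank_one_of_esymm_mem`, `not_isUpperTriangular_conj_of_esymm_mem` — `π`
  L-ARITHMETIC (its unramified Hecke eigenvalues `e_i(t_{π,v})` lie in a number field `E ⊂ ℂ` at almost
  all `v`; Buzzard–Gee Def. 3.1.4): every a.e.-compatible `ρ` is `E`-rational
  (`eventually_rational_of_esymm_mem`), so NO a.e.-compatible `ρ` has abelian semisimplification and
  NONE is triangularisable over `ℚ̄_ℓ` (no `P ∈ GL_n(ℚ̄_ℓ)` makes `P ρ P⁻¹` upper triangular:
  `exists_charpoly_eq_prod_of_isUpperTriangular`, p130538);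
* `not_charpoly_eq_prod_rank_one_of_isRegular`, `not_isUpperTriangular_conj_of_isRegular` — `π`
  L-algebraic with a REGULAR infinity type, every rank `n ≥ 2` and every `K`, modulo Clozel's Hecke
  field (the text of the route input `HeckeEigenvalueField`): regular L-algebraic `π` are L-arithmetic
  (`exists_heckeField_of_isLAlgebraic_of_isRegular`, p130609);
* `no_triangular_avatar_text_of_isRegular` — the same in the binder shape of the crux
  `IrreducibleOffSector` (with `2 ≤ n` and the regularity of an infinity type added, the sector clause
  dropped): its conclusion `ρ.toGaloisRep.IsIrreducible` is replaced by the proved shadow "`ρ` is not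
  triangularisable", i.e. among the shapes a reducible avatar could have, the Borel one is excluded in
  every rank — what is left open is exactly a non-automorphic irreducible constituent of rank `≥ 2`
  (`exists_block_not_weaklyAutomorphic_of_rational`).

References: G. Böckle, C.-Y. Hui, Math. Ann. 393 (2025), Thm. 1.1, §3.2.1; K. Ribet, LNM 601 (1977),
Thm. 2.3; L. Clozel, *Motifs et formes automorphes* (1990), Thm. 3.13; K. Buzzard, T. Gee, LMS LNS 414
(2014), Def. 3.1.4, §5.3; H. Jacquet, J. Shalika, Amer. J. Math. 103 (1981) II, Thm. 4.4.
-/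

noncomputable section

set_option linter.dupNamespace false

open scoped NumberField Classical Polynomial
open Filter IsDedekindDomain Polynomial NumberField
open Literature.NumberTheory.Automorphic Literature.NumberTheory.GaloisRepresentations
open Summit.Langlands

namespace Summit.Langlands.Langlands.Theorems.IrreducibleOffSector

/-! ### L-arithmetic `π` -/

/-- **No abelian avatars of an L-arithmetic cuspidal `π`** (`n ≥ 2`, every `K`, no archimedean
hypothesis).  Grant Böckle–Hui 2025 Thm. 1.1 in cofinite `GL(1)` form (`hWA`) and Arthur–Clozel (2.2)
(`h22`).  If the unramified Hecke eigenvalues `e_i(t_{π,v})`, `i ≤ n`, of `π` lie in a number field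
`E ⊂ ℂ` at almost all `v`, then for every `ρ : Γ_K → GL_n(ℚ̄_ℓ)` Satake–Frobenius compatible with
`(π, ι)` at almost all places and every family of continuous characters `χ_i : Γ_K → GL_1(ℚ̄_ℓ)`,
`det(X - ρ σ) ≠ ∏ᵢ det(X - χ_i σ)` for some `σ` (`ρ` is `E`-rational by `eventually_rational_of_esymm_mem`).
[cite: BockleHui2025, Theorem 1.1 and §3.2.1] [cite: BuzzardGeeLMS2014, Def. 3.1.4] -/
theorem not_charpoly_eq_prod_rank_one_of_esymm_mem
    (hWA : ∀ (K : Type) [Field K] [NumberField K] (h1 : isCompact_glFiniteIntegralLevel 1 K) (ℓ : ℕ) [Fact ℓ.Prime] (n : ℕ) (E : Type) [Field E] [NumberField E] (e : E →+* PadicAlgCl ℓ) (ρ : Literature.NumberTheory.GaloisRepresentations.FramedGaloisRep K (PadicAlgCl ℓ) n), ρ.toGaloisRep.IsSemisimple → (∀ᶠ v in cofinite, ρ.IsUnramifiedAt v ∧ ∃ P : Polynomial E, ρ.HasFrobCharpolyAt v (P.map e)) → ∀ (ψ : Literature.NumberTheory.GaloisRepresentations.FramedGaloisRep K (PadicAlgCl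 ℓ) 1), (∀ᶠ v in cofinite, ρ.IsUnramifiedAt v ∧ ψ.IsUnramifiedAt v ∧ ∀ 𝔓 ∈ v.primesAbove, ∀ σ : Field.absoluteGaloisGroup K, IsArithFrobAt (NumberField.RingOfIntegers K) σ 𝔓 → ψ.charpoly σ ∣ ρ.charpoly σ) → ∀ (ι : PadicAlgCl ℓ ≃+* ℂ), ∃ χ : Literature.NumberTheory.Automorphic.CuspidalAutomorphicRepData 1 K h1, χ.1.IsRegularAlgebraic ∧ ∀ᶠ v in cofinite, ∃ c : ℂ, χ.1.HasSatakeParamAt v {c} ∧ ψ.IsUnramifiedAt v ∧ ψ.HasFrobCharpolyAt v (Literature.NumberTheory.Automorphic.arithFrobPolyOfSatake ι v.residueCard 1 {c}))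
    (h22 : JacquetShalika1981_partialPairL_boundary_repData)
    {K : Type} [Field K] [NumberField K] {n : ℕ} (hn : 2 ≤ n)
    {hcpt : isCompact_glFiniteIntegralLevel n K} (π : CuspidalAutomorphicRepData n K hcpt)
    (hE : ∃ E : Subfield ℂ, FiniteDimensional ℚ E ∧
      ∀ᶠ v : HeightOneSpectrum (𝓞 K) in cofinite, ∀ α : Multiset ℂ, π.1.HasSatakeParamAt v α →
        ∀ i ≤ n, α.esymm i ∈ E)
    {ℓ : ℕ} [Fact ℓ.Prime] (ι : PadicAlgCl ℓ ≃+* ℂ) (ρ : FramedGaloisRep K (PadicAlgCl ℓ) n)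
    (hρ : ∀ᶠ v : HeightOneSpectrum (𝓞 K) in cofinite, SatakeFrobCompatibleAt ι π.1 ρ v)
    (χ : Fin n → FramedGaloisRep K (PadicAlgCl ℓ) 1) :
    ¬ ∀ σ, ρ.charpoly σ = ∏ i, (χ i).charpoly σ := by
  obtain ⟨E, hfd, hE⟩ := hE
  haveI : FiniteDimensional ℚ E := hfd
  haveI : NumberField E := NumberField.mk
  exact not_charpoly_eq_prod_rank_one_of_rational hWA h22 hn π ι
    ((ι.symm : ℂ ≃+* PadicAlgCl ℓ).toRingHom.comp E.subtype) ρ hρ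
    (eventually_rational_of_esymm_mem π.1 ι E hE ρ hρ) χ

/-- **No triangularisable avatars of an L-arithmetic cuspidal `π`** (`n ≥ 2`, every `K`): under the
hypotheses of `not_charpoly_eq_prod_rank_one_of_esymm_mem`, no a.e.-compatible `ρ` has an upper
triangular conjugate `P ρ P⁻¹`, `P ∈ GL_n(ℚ̄_ℓ)` — its diagonal characters would factor `det(X - ρ)`
(`exists_charpoly_eq_prod_of_isUpperTriangular`).  In particular `ρ` has no stable complete flag, and a
reducible `ρ` has an irreducible constituent of dimension `≥ 2`.
[cite: BockleHui2025, Theorem 1.1 and §3.2.1] [cite: BuzzardGeeLMS2014, Def. 3.1.4] -/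
theorem not_isUpperTriangular_conj_of_esymm_mem
    (hWA : ∀ (K : Type) [Field K] [NumberField K] (h1 : isCompact_glFiniteIntegralLevel 1 K) (ℓ : ℕ) [Fact ℓ.Prime] (n : ℕ) (E : Type) [Field E] [NumberField E] (e : E →+* PadicAlgCl ℓ) (ρ : Literature.NumberTheory.GaloisRepresentations.FramedGaloisRep K (PadicAlgCl ℓ) n), ρ.toGaloisRep.IsSemisimple → (∀ᶠ v in cofinite, ρ.IsUnramifiedAt v ∧ ∃ P : Polynomial E, ρ.HasFrobCharpolyAt v (P.map e)) → ∀ (ψ : Literature.NumberTheory.GaloisRepresentations.FramedGaloisRep K (PadicAlgCl ℓ) 1), (∀ᶠ v in cofinite, ρ.IsUnramifiedAt v ∧ ψ.IsUnramifiedAt v ∧ ∀ 𝔓 ∈ v.primesAbove, ∀ σ : Field.absoluteGaloisGroup K, IsArithFrobAt (NumberField.RingOfIntegers K) σ 𝔓 → ψ.charpoly σ ∣ ρ.charpoly σ) → ∀ (ι : PadicAlgCl ℓ ≃+* ℂ), ∃ χ : Literature.NumberTheory.Automorphic.CuspidalAutomorphicRepData 1 K h1, χ.1.IsRegularAlgebraic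 ∧ ∀ᶠ v in cofinite, ∃ c : ℂ, χ.1.HasSatakeParamAt v {c} ∧ ψ.IsUnramifiedAt v ∧ ψ.HasFrobCharpolyAt v (Literature.NumberTheory.Automorphic.arithFrobPolyOfSatake ι v.residueCard 1 {c}))
    (h22 : JacquetShalika1981_partialPairL_boundary_repData)
    {K : Type} [Field K] [NumberField K] {n : ℕ} (hn : 2 ≤ n)
    {hcpt : isCompact_glFiniteIntegralLevel n K} (π : CuspidalAutomorphicRepData n K hcpt)
    (hE : ∃ E : Subfield ℂ, FiniteDimensional ℚ E ∧
      ∀ᶠ v : HeightOneSpectrum (𝓞 K) in cofinite, ∀ α : Multiset ℂ, π.1.HasSatakeParamAt v α →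
        ∀ i ≤ n, α.esymm i ∈ E)
    {ℓ : ℕ} [Fact ℓ.Prime] (ι : PadicAlgCl ℓ ≃+* ℂ) (ρ : FramedGaloisRep K (PadicAlgCl ℓ) n)
    (hρ : ∀ᶠ v : HeightOneSpectrum (𝓞 K) in cofinite, SatakeFrobCompatibleAt ι π.1 ρ v)
    (P : GL (Fin n) (PadicAlgCl ℓ)) : ¬ (ρ.conj P).IsUpperTriangular := by
  intro hT
  obtain ⟨χ, hχ⟩ := exists_charpoly_eq_prod_of_isUpperTriangular ρ P hT
  exact not_charpoly_eq_prod_rank_one_of_esymm_mem hWA h22 hn π hE ι ρ hρ χ hχ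

/-! ### Regular L-algebraic `π` (Clozel's Hecke field) -/

/-- **No abelian avatars of a regular L-algebraic cuspidal `π`** (every rank `n ≥ 2`, every number
field `K`).  Grant Böckle–Hui 2025 Thm. 1.1 in cofinite `GL(1)` form (`hWA`), Clozel's Hecke field
for regular algebraic `π` (`hHE`, the text of the route input `HeckeEigenvalueField`) and Arthur–Clozel
(2.2) (`h22`).  For every cuspidal `π` on `GL_n(𝔸_K)` that is L-algebraic with a regular infinity type,
every `ρ : Γ_K → GL_n(ℚ̄_ℓ)` Satake–Frobenius compatible with `(π, ι)` at almost all places and every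
family of continuous characters `χ_i`, `det(X - ρ) ≠ ∏ᵢ det(X - χ_i)`: regular L-algebraic `π` are
L-arithmetic (`exists_heckeField_of_isLAlgebraic_of_isRegular`).
[cite: Clozel1990, Thm. 3.13] [cite: BockleHui2025, Theorem 1.1 and §3.2.1] -/
theorem not_charpoly_eq_prod_rank_one_of_isRegular
    (hWA : ∀ (K : Type) [Field K] [NumberField K] (h1 : isCompact_glFiniteIntegralLevel 1 K) (ℓ : ℕ) [Fact ℓ.Prime] (n : ℕ) (E : Type) [Field E] [NumberField E] (e : E →+* PadicAlgCl ℓ) (ρ : Literature.NumberTheory.GaloisRepresentations.FramedGaloisRep K (PadicAlgCl ℓ) n), ρ.toGaloisRep.IsSemisimple → (∀ᶠ v in cofinite, ρ.IsUnramifiedAt v ∧ ∃ P : Polynomial E, ρ.HasFrobCharpolyAt v (P.map e)) → ∀ (ψ : Literature.NumberTheory.GaloisRepresentations.FramedGaloisRep K (PadicAlgCl ℓ) 1), (∀ᶠ v in cofinite, ρ.IsUnramifiedAt v ∧ ψ.IsUnramifiedAt v ∧ ∀ 𝔓 ∈ v.primesAbove, ∀ σ : Field.absoluteGaloisGroup K,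 IsArithFrobAt (NumberField.RingOfIntegers K) σ 𝔓 → ψ.charpoly σ ∣ ρ.charpoly σ) → ∀ (ι : PadicAlgCl ℓ ≃+* ℂ), ∃ χ : Literature.NumberTheory.Automorphic.CuspidalAutomorphicRepData 1 K h1, χ.1.IsRegularAlgebraic ∧ ∀ᶠ v in cofinite, ∃ c : ℂ, χ.1.HasSatakeParamAt v {c} ∧ ψ.IsUnramifiedAt v ∧ ψ.HasFrobCharpolyAt v (Literature.NumberTheory.Automorphic.arithFrobPolyOfSatake ι v.residueCard 1 {c}))
    (hHE : ∀ (n : ℕ) (K : Type) [Field K] [NumberField K] (hcpt : Literature.NumberTheory.Automorphic.isCompact_glFiniteIntegralLevel n K) (π : Literature.NumberTheory.Automorphic.CuspidalAutomorphicRepData n K hcpt), π.1.IsRegularAlgebraic → ∃ E : Subfield ℂ, FiniteDimensional ℚ E ∧ ∀ᶠ v in cofinite, ∀ α : Multiset ℂ, π.1.HasSatakeParamAt v α → ∀ i ≤ n, ((((Real.sqrt (v.residueCard : ℝ)) : ℝ) : ℂ) ^ (i * (n - i))) * α.esymm i ∈ E)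
    (h22 : JacquetShalika1981_partialPairL_boundary_repData)
    {K : Type} [Field K] [NumberField K] {n : ℕ} (hn : 2 ≤ n)
    {hcpt : isCompact_glFiniteIntegralLevel n K} (π : CuspidalAutomorphicRepData n K hcpt)
    (hL : π.1.IsLAlgebraic) (hreg : ∃ T : InfinityType K n, π.1.HasInfinityType T ∧ T.IsRegular)
    {ℓ : ℕ} [Fact ℓ.Prime] (ι : PadicAlgCl ℓ ≃+* ℂ) (ρ : FramedGaloisRep K (PadicAlgCl ℓ) n)
    (hρ : ∀ᶠ v : HeightOneSpectrum (𝓞 K) in cofinite, SatakeFrobCompatibleAt ι π.1 ρ v)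
    (χ : Fin n → FramedGaloisRep K (PadicAlgCl ℓ) 1) :
    ¬ ∀ σ, ρ.charpoly σ = ∏ i, (χ i).charpoly σ := by
  haveI : NeZero n := ⟨by omega⟩
  exact not_charpoly_eq_prod_rank_one_of_esymm_mem hWA h22 hn π
    (exists_heckeField_of_isLAlgebraic_of_isRegular hHE π hL hreg) ι ρ hρ χ

/-- **No triangularisable avatars of a regular L-algebraic cuspidal `π`** (every rank `n ≥ 2`, every
`K`), modulo `hWA`, Clozel's Hecke field `hHE` and (2.2): no a.e.-compatible `ρ` has an upper triangular
conjugate `P ρ P⁻¹`. [cite: Clozel1990, Thm. 3.13] [cite: BockleHui2025, Theorem 1.1 and §3.2.1] -/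
theorem not_isUpperTriangular_conj_of_isRegular
    (hWA : ∀ (K : Type) [Field K] [NumberField K] (h1 : isCompact_glFiniteIntegralLevel 1 K) (ℓ : ℕ) [Fact ℓ.Prime] (n : ℕ) (E : Type) [Field E] [NumberField E] (e : E →+* PadicAlgCl ℓ) (ρ : Literature.NumberTheory.GaloisRepresentations.FramedGaloisRep K (PadicAlgCl ℓ) n), ρ.toGaloisRep.IsSemisimple → (∀ᶠ v in cofinite, ρ.IsUnramifiedAt v ∧ ∃ P : Polynomial E, ρ.HasFrobCharpolyAt v (P.map e)) → ∀ (ψ : Literature.NumberTheory.GaloisRepresentations.FramedGaloisRep K (PadicAlgCl ℓ) 1), (∀ᶠ v in cofinite, ρ.IsUnramifiedAt v ∧ ψ.IsUnramifiedAt v ∧ ∀ 𝔓 ∈ v.primesAbove, ∀ σ : Field.absoluteGaloisGroup K, IsArithFrobAt (NumberField.RingOfIntegers K) σ 𝔓 → ψ.charpoly σ ∣ ρ.charpoly σ) → ∀ (ι : PadicAlgCl ℓ ≃+* ℂ), ∃ χ : Literature.NumberTheory.Automorphic.CuspidalAutomorphicRepData 1 K h1, χ.1.IsRegularAlgebraic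 ∧ ∀ᶠ v in cofinite, ∃ c : ℂ, χ.1.HasSatakeParamAt v {c} ∧ ψ.IsUnramifiedAt v ∧ ψ.HasFrobCharpolyAt v (Literature.NumberTheory.Automorphic.arithFrobPolyOfSatake ι v.residueCard 1 {c}))
    (hHE : ∀ (n : ℕ) (K : Type) [Field K] [NumberField K] (hcpt : Literature.NumberTheory.Automorphic.isCompact_glFiniteIntegralLevel n K) (π : Literature.NumberTheory.Automorphic.CuspidalAutomorphicRepData n K hcpt), π.1.IsRegularAlgebraic → ∃ E : Subfield ℂ, FiniteDimensional ℚ E ∧ ∀ᶠ v in cofinite, ∀ α : Multiset ℂ, π.1.HasSatakeParamAt v α → ∀ i ≤ n, ((((Real.sqrt (v.residueCard : ℝ)) : ℝ) : ℂ) ^ (i * (n - i))) * α.esymm i ∈ E)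
    (h22 : JacquetShalika1981_partialPairL_boundary_repData)
    {K : Type} [Field K] [NumberField K] {n : ℕ} (hn : 2 ≤ n)
    {hcpt : isCompact_glFiniteIntegralLevel n K} (π : CuspidalAutomorphicRepData n K hcpt)
    (hL : π.1.IsLAlgebraic) (hreg : ∃ T : InfinityType K n, π.1.HasInfinityType T ∧ T.IsRegular)
    {ℓ : ℕ} [Fact ℓ.Prime] (ι : PadicAlgCl ℓ ≃+* ℂ) (ρ : FramedGaloisRep K (PadicAlgCl ℓ) n)
    (hρ : ∀ᶠ v : HeightOneSpectrum (𝓞 K) in cofinite, SatakeFrobCompatibleAt ι π.1 ρ v)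
    (P : GL (Fin n) (PadicAlgCl ℓ)) : ¬ (ρ.conj P).IsUpperTriangular := by
  haveI : NeZero n := ⟨by omega⟩
  exact not_isUpperTriangular_conj_of_esymm_mem hWA h22 hn π
    (exists_heckeField_of_isLAlgebraic_of_isRegular hHE π hL hreg) ι ρ hρ P

/-! ### In the binder shape of the crux -/

/-- **The proved shadow of `IrreducibleOffSector` on the regular locus, every rank `n ≥ 2` and every
number field**: in the binders of the crux (rank `n`, field `K`, level, L-algebraic cuspidal `π`, `ℓ`,
`ι`, a.e.-compatible `ρ`), with `2 ≤ n` and the regularity of an infinity type of `π` added and the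
sector clause dropped (it only shrinks the domain), the conclusion "`ρ` irreducible" is open, but its
consequence "`ρ` is not triangularisable over `ℚ̄_ℓ`" (no `P` with `P ρ P⁻¹` upper triangular; so no
abelian semisimplification, no stable complete flag) HOLDS — modulo Böckle–Hui Thm. 1.1 (`hWA`, a tree
theorem as `WeakAbelianSummandHecke`), Clozel's Hecke field (`hHE`) and Arthur–Clozel (2.2) (`h22`).
[cite: Clozel1990, Thm. 3.13] [cite: BockleHui2025, Theorem 1.1 and §3.2.1]
[cite: JacquetShalikaAJM1981II, Thm. 4.4] -/
theorem no_triangular_avatar_text_of_isRegular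
    (hWA : ∀ (K : Type) [Field K] [NumberField K] (h1 : isCompact_glFiniteIntegralLevel 1 K) (ℓ : ℕ) [Fact ℓ.Prime] (n : ℕ) (E : Type) [Field E] [NumberField E] (e : E →+* PadicAlgCl ℓ) (ρ : Literature.NumberTheory.GaloisRepresentations.FramedGaloisRep K (PadicAlgCl ℓ) n), ρ.toGaloisRep.IsSemisimple → (∀ᶠ v in cofinite, ρ.IsUnramifiedAt v ∧ ∃ P : Polynomial E, ρ.HasFrobCharpolyAt v (P.map e)) → ∀ (ψ : Literature.NumberTheory.GaloisRepresentations.FramedGaloisRep K (PadicAlgCl ℓ) 1), (∀ᶠ v in cofinite, ρ.IsUnramifiedAt v ∧ ψ.IsUnramifiedAt v ∧ ∀ 𝔓 ∈ v.primesAbove, ∀ σ : Field.absoluteGaloisGroup K, IsArithFrobAt (NumberField.RingOfIntegers K) σ 𝔓 → ψ.charpoly σ ∣ ρ.charpoly σ) → ∀ (ι : PadicAlgCl ℓ ≃+* ℂ), ∃ χ : Literature.NumberTheory.Automorphic.CuspidalAutomorphicRepData 1 K h1, χ.1.IsRegularAlgebraic ∧ ∀ᶠ v in cofinite, ∃ c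 : ℂ, χ.1.HasSatakeParamAt v {c} ∧ ψ.IsUnramifiedAt v ∧ ψ.HasFrobCharpolyAt v (Literature.NumberTheory.Automorphic.arithFrobPolyOfSatake ι v.residueCard 1 {c}))
    (hHE : ∀ (n : ℕ) (K : Type) [Field K] [NumberField K] (hcpt : Literature.NumberTheory.Automorphic.isCompact_glFiniteIntegralLevel n K) (π : Literature.NumberTheory.Automorphic.CuspidalAutomorphicRepData n K hcpt), π.1.IsRegularAlgebraic → ∃ E : Subfield ℂ, FiniteDimensional ℚ E ∧ ∀ᶠ v in cofinite, ∀ α : Multiset ℂ, π.1.HasSatakeParamAt v α → ∀ i ≤ n, ((((Real.sqrt (v.residueCard : ℝ)) : ℝ) : ℂ) ^ (i * (n - i))) * α.esymm i ∈ E)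
    (h22 : JacquetShalika1981_partialPairL_boundary_repData) :
    ∀ (n : ℕ) (K : Type) [Field K] [NumberField K]
      (hcpt : Literature.NumberTheory.Automorphic.isCompact_glFiniteIntegralLevel n K), 2 ≤ n →
      ∀ (π : Literature.NumberTheory.Automorphic.CuspidalAutomorphicRepData n K hcpt), π.1.IsLAlgebraic →
        (∃ T : Literature.NumberTheory.Automorphic.InfinityType K n, π.1.HasInfinityType T ∧ T.IsRegular) →
        ∀ (ℓ : ℕ) [Fact ℓ.Prime] (ι : PadicAlgCl ℓ ≃+* ℂ)
          (ρ : Literature.NumberTheory.GaloisRepresentations.FramedGaloisRep K (PadicAlgCl ℓ) n),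
          (∀ᶠ v : IsDedekindDomain.HeightOneSpectrum (NumberField.RingOfIntegers K) in cofinite,
            SatakeFrobCompatibleAt ι π.1 ρ v) →
            ∀ P : GL (Fin n) (PadicAlgCl ℓ), ¬ (ρ.conj P).IsUpperTriangular :=
  fun _n _K _ _ _hcpt hn π hL hreg _ℓ _ ι ρ hρ P =>
    not_isUpperTriangular_conj_of_isRegular hWA hHE h22 hn π hL hreg ι ρ hρ P

end Summit.Langlands.Langlands.Theorems.IrreducibleOffSector

end
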